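import Summits.BirchSwinnertonDyer.BirchSwinnertonDyer.Theorems.EisensteinPrimesMazurMCOnCellBTwistbackKLFlatPartnerUnits
import Summits.BirchSwinnertonDyer.BirchSwinnertonDyer.Theorems.EisensteinPrimesLinePsiAtMultiplicativePrime
import HarnessLib

/-!
# Crux 3 `MazurMCOnCellB` (stmt-BirchSwinnertonDyer-19033), line `twistback` v4 — the KL-flat door with the
# per-pair hypothesis `ψ(p) ≠ 1` DISCHARGED (brick (F3) plugged into p645771 §2/§3)

Width seat bsd-line-x2-p1-w7 (g0). HONEST FRAMING (cell `bsd-eis`, run/shared/lean/pub/bsd-eis/): conditional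
theorems only — inputs BY NAME as in LEAD g10's p645771 (`…TwistbackKLFlatPartnerUnits`): the route's
`PublishedInputs` (stmt-…-19037), Disegni 2020 Thm. 4(1) (PUB), Greenberg–Vatsal Thm. (3.11)+(28) (PUB, F1), and
PER PAIR the line datum, ONE Bernoulli unit, local balance `1` (+ STEP L and one admissible `K` for §2); nothing
booked; no main conjecture / BSD proved for any curve unconditionally; no summit statement is proved;
0 cells / labels / tiers move. No `def`, no named fact, no `sorry`.

WHAT. p645771 §2 `missingUpperBoundAt_of_cellC_of_not_split_of_bernoulliUnit_isogenous` and §3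
`mazurMainConjectureAt_of_cellB_of_not_split_of_indexLowerBoundAt_of_bernoulliUnit_twist` carry the binder
`hψℓ` / `hψp : ψ (p : ZMod d) ≠ 1` ("no trivial zero of `L_p(ωψ⁻¹, s)` at `s = 0`"). By brick (F3)
(`EisensteinPrimesLinePsiAtMultiplicativePrime`, p649032): at a NON-split odd multiplicative prime the quotient
character of a RAMIFIED rational line has `ψ(p) = −1 ≠ 1` — on the carrier `V′` this follows from the other
binders already present (`hcV`/`hc`, `hns`, `hiso` (+ `hK`, `hHp`, `hWd`), `hΦ`, `hram`, `hℓd`/`hpd`, `hψ0`).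
This file restates the two doors WITHOUT that binder:

* §1 `missingUpperBoundAt_of_cellC_of_not_split_of_bernoulliUnit_isogenous'` — PER PARTNER (X2c, non-split):
  `BSD(V, ℓ) ∧ Upper(V, ℓ)` from a ramified-even line on an isogenous carrier, the Weil relation, ONE unit
  `‖B₁^{(d)}(ω̃∘ψ⁻¹)‖_ℓ = 1` and local balance `1` — `ψ(ℓ) ≠ 1` no longer assumed;
* §2 `mazurMainConjectureAt_of_cellB_of_not_split_of_indexLowerBoundAt_of_bernoulliUnit_twist'` — PER PAIR
  (X2b, non-split): Mazur's MC at `(W, p)` from STEP L at ONE Heegner datum, ONE admissible `K` with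
  `r_an(E^{(d_K)}) = 1`, a carrier isogenous to the twist with a ramified-even line, the Weil relation, ONE
  Bernoulli unit and local balance `1` — `ψ(p) ≠ 1` no longer assumed.

References: [GreenbergVatsal2000] §2 pp. 14–15, p. 28, §3 Thm. (3.11) p. 43; [SilvermanATAEC1994] Ch. V
Lemma 5.2 (c), Thm. 5.3, Cor. 5.4; [Washington1997] Thm. 5.11; [Disegni2020] Thm. 4 (§3.2); [Wuthrich2014]
Thm. 16; [JetchevSkinnerWan2017] §7.4.1.
-/

set_option autoImplicit false

-- `Summit.BirchSwinnertonDyer.BirchSwinnertonDyer.…`: the summit and its single sub-problem share a name.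
set_option linter.dupNamespace false

noncomputable section

open scoped Classical MatrixGroups ModularForm

open CongruenceSubgroup WeierstrassCurve NumberField IsDedekindDomain Field PowerSeries
  Literature.NumberTheory.EllipticCurves
  Literature.NumberTheory.GaloisRepresentations
  Literature.NumberTheory.EllipticCurves.ModularForms
  Literature.NumberTheory.QuadraticFields
  Literature.NumberTheory.EllipticCurves.Rank1Residual
  Literature.NumberTheory.EllipticCurves.Rank1Residual.Typed
  Literature.NumberTheory.EllipticCurves.GreenbergVatsal2000
  Literature.NumberTheory.EllipticCurves.Disegni2020
  Summit.BirchSwinnertonDyer.Rank1Residual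
  Summit.BirchSwinnertonDyer.BirchSwinnertonDyer.Theses
  Summit.BirchSwinnertonDyer.BirchSwinnertonDyer.Theorems.EisensteinPrimesMazurMCOnCellBTwistbackKLFlatPartnerUnits
  Summit.BirchSwinnertonDyer.BirchSwinnertonDyer.Theorems.EisensteinPrimesLinePsiAtMultiplicativePrime

namespace Summit.BirchSwinnertonDyer.BirchSwinnertonDyer.Theorems.EisensteinPrimesMazurMCOnCellBTwistbackKLFlatPartnerUnitsPsi

/-! ## §1. PER PARTNER: the upper half from ONE Bernoulli unit, `ψ(ℓ) ≠ 1` discharged -/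

/-- **PER PARTNER, NON-SPLIT: `BSD(V, ℓ)` and its upper half from a ramified-even line datum on an isogenous
carrier with ONE Bernoulli unit — WITHOUT the hypothesis `ψ(ℓ) ≠ 1`** (p645771 §2 with `hψℓ` supplied by
`EisensteinPrimesLinePsiAtMultiplicativePrime.psi_natCast_eq_neg_one_of_isIsogenous_of_not_split`: `V′` is
`ℚ`-isogenous to the non-split X2c curve `V`, `Φ₀` is ramified, so `ψ(ℓ) = −1 ≠ 1`, `ℓ` odd).
[cite: GreenbergVatsal2000, §3 Thm. (3.11) (p. 43) with (26)–(28) and §2 pp. 14–15, 28] [cite: Wuthrich2014, Thm. 16 (p. 397)]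
[cite: Disegni2020, Thm. 4 (§3.2)] [cite: SilvermanATAEC1994, Ch. V Lemma 5.2 (c), Thm. 5.3 (a),(b), Cor. 5.4 (held copy PDF pp. 406–410)] -/
theorem missingUpperBoundAt_of_cellC_of_not_split_of_bernoulliUnit_isogenous'
    (hP : EisensteinPrimes.PublishedInputs)
    (hDis : padicBSD_rankOne_nonsplitMult) (h311 : thm311_hasUnitContent_iff_and_order_eq_of_lineRamifiedEven)
    (V : WeierstrassCurve ℚ) [V.IsElliptic] [V.IsGloballyMinimal] (ℓ : ℕ) [Fact ℓ.Prime]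
    (hcV : X2.CellC V ℓ) (hns : ¬ V.HasSplitMultiplicativeReductionAtPrime ℓ)
    (V' : WeierstrassCurve ℚ) [V'.IsElliptic] [V'.IsGloballyMinimal] (hiso : IsIsogenous V V')
    (S₀ : Finset (HeightOneSpectrum (𝓞 ℚ))) (Φ₀ : AddSubgroup (V'.geomTorsion (ℓ : ℤ)))
    (m : ℕ) [NeZero m] (φ : DirichletCharacter (ZMod ℓ) m)
    (d : ℕ) [NeZero d] (ψ : DirichletCharacter (ZMod ℓ) d)
    (hΦ : IsRationalLine V' ℓ Φ₀) (hram : ¬ LineUnramifiedAt V' ℓ Φ₀) (heven : LineEven V' ℓ Φ₀)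
    (hφ : φ.IsPrimitive) (hψ : ψ.IsPrimitive) (hℓm : ℓ ∣ m) (hℓd : ¬ ℓ ∣ d)
    (hφ0 : ∀ (σ : absoluteGaloisGroup ℚ), ∀ P ∈ Φ₀,
      σ • P = (φ ((modNCyclotomicCharacter ℚ m σ : (ZMod m)ˣ) : ZMod m)).val • P)
    (hψ0 : ∀ (σ : absoluteGaloisGroup ℚ) (P : V'.geomTorsion (ℓ : ℤ)),
      σ • P - (ψ ((modNCyclotomicCharacter ℚ d σ : (ZMod d)ˣ) : ZMod d)).val • P ∈ Φ₀)
    (hS₀p : ∀ v ∈ S₀, ((ℓ : ℕ) : 𝓞 ℚ) ∉ v.asIdeal)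
    (hS : ∀ v : HeightOneSpectrum (𝓞 ℚ), v ∉ S₀ → ((ℓ : ℕ) : 𝓞 ℚ) ∉ v.asIdeal → V'.HasGoodReductionAt v)
    (hφψ : ∀ a : ℕ, ¬ ℓ ∣ a → φ (a : ZMod m) * (a : ZMod ℓ)⁻¹ = ψ⁻¹ (a : ZMod d))
    (hB : ‖twistedBernoulli ℓ 1 d (fun a : ℕ ↦ teichmullerLift ℓ (ψ (a : ZMod d))⁻¹)‖ = 1)
    (hbal : 1 + ∑ v ∈ S₀, delta V' ℓ v =
      ∑ v ∈ S₀, ((if φ (Rat.HeightOneSpectrum.natGenerator v : ZMod m) =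
            (Rat.HeightOneSpectrum.natGenerator v : ZMod ℓ)
          then sFactor ℓ (Rat.HeightOneSpectrum.natGenerator v) else 0) +
        (if ψ (Rat.HeightOneSpectrum.natGenerator v : ZMod d) =
            (Rat.HeightOneSpectrum.natGenerator v : ZMod ℓ)
          then sFactor ℓ (Rat.HeightOneSpectrum.natGenerator v) else 0))) :
    BSDp V ℓ ∧ MissingUpperBoundAt V ℓ := by
  have hψℓ' : ψ (ℓ : ZMod d) = -1 :=
    psi_natCast_eq_neg_one_of_isIsogenous_of_not_split hcV.2.1 hcV.2.2.2 hns V' hiso hΦ hram ψ hℓd hψ0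
  have hψℓ : ψ (ℓ : ZMod d) ≠ 1 := by
    rw [hψℓ']
    intro h
    have h2 : (2 : ZMod ℓ) = 0 := by linear_combination -h
    have : (ℓ : ℕ) ∣ 2 := by
      rw [show (2 : ZMod ℓ) = ((2 : ℕ) : ZMod ℓ) by norm_cast] at h2
      exact (ZMod.natCast_eq_zero_iff 2 ℓ).mp h2
    exact hcV.2.1 ((Nat.prime_dvd_prime_iff_eq (Fact.out : ℓ.Prime) Nat.prime_two).mp this)
  exact missingUpperBoundAt_of_cellC_of_not_split_of_bernoulliUnit_isogenous hP hDis h311 V ℓ hcV hns V' hiso S₀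
    Φ₀ m φ d ψ hΦ hram heven hφ hψ hℓm hℓd hφ0 hψ0 hS₀p hS hφψ hψℓ hB hbal

/-! ## §2. PER PAIR, NON-SPLIT X2b: Mazur's MC from STEP L + ONE admissible `K` + ONE unit, `ψ(p) ≠ 1` discharged -/

/-- **PER PAIR, NON-SPLIT: Mazur's main conjecture at an X2b pair `(W, p)` — p645771 §3 WITHOUT the hypothesis
`ψ(p) ≠ 1`** (supplied by `EisensteinPrimesLinePsiAtMultiplicativePrime.psi_natCast_ne_one_of_twist_carrier`: the
twist by `K` with `p` split keeps the non-split type, the isogeny to the carrier too, and `Φ₀` is ramified, so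
`ψ(p) = −1 ≠ 1`). Inputs otherwise verbatim: `PublishedInputs`, Disegni Thm. 4(1), GV Thm. (3.11), STEP L at ONE
Heegner datum (`hlow`), ONE admissible `K` with `r_an(E^{(d_K)}) = 1`, the carrier's line datum with primitive
characters and the Weil relation, ONE Bernoulli unit, local balance `1`. BSD / MC proved for no curve
unconditionally. [cite: JetchevSkinnerWan2017, §7.4.1] [cite: GreenbergVatsal2000, §3 Thm. (3.11) (p. 43) and §2 pp. 14–15, 28]
[cite: Washington1997, Thm. 4.17 and Thm. 5.11] [cite: Disegni2020, Thm. 4 (§3.2)] [cite: Wuthrich2014, Thm. 16 (p. 397)]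
[cite: SilvermanATAEC1994, Ch. V Lemma 5.2 (c), Thm. 5.3 (a),(b), Cor. 5.4 (held copy PDF pp. 406–410)] -/
theorem mazurMainConjectureAt_of_cellB_of_not_split_of_indexLowerBoundAt_of_bernoulliUnit_twist'
    (hP : EisensteinPrimes.PublishedInputs) (hDis : padicBSD_rankOne_nonsplitMult)
    (h311 : thm311_hasUnitContent_iff_and_order_eq_of_lineRamifiedEven)
    (W : WeierstrassCurve ℚ) [W.IsElliptic] [W.IsGloballyMinimal] (p : ℕ) [Fact p.Prime]
    (hc : X2.CellB W p) (hns : ¬ W.HasSplitMultiplicativeReductionAtPrime p)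
    (N : ℕ) [NeZero N] (K : Type) [Field K] [NumberField K]
    (Dt : ModularParametrizationData W N) (H : HeegnerDatum N (NumberField.discr K)) (ι : K →+* ℂ)
    (P : (W.baseChange K).toAffine.Point)
    (hK : IsImaginaryQuadratic K) (hodd : Odd (NumberField.discr K)) (hlt : NumberField.discr K < -4)
    (hN : W.conductorNorm ℤ = N) (hHN : SatisfiesHeegnerHypothesis N K)
    (hHp : SatisfiesHeegnerHypothesis p K)
    (hPt : WeierstrassCurve.Affine.Point.map ι.toRatAlgHom P = heegnerPointComplex Dt H)
    (hcM : ¬ (p : ℤ) ∣ Dt.c)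
    (Wd : WeierstrassCurve ℚ) [Wd.IsElliptic] [Wd.IsGloballyMinimal]
    (hWd : ∃ C : VariableChange ℚ, C • Wd = W.quadraticTwist (NumberField.discr K : ℚ))
    (hrd : Wd.analyticRank = 1)
    (hlow : Finite (W.baseChange K).sha → X11b.IndexLowerBoundAt W p K P)
    (V' : WeierstrassCurve ℚ) [V'.IsElliptic] [V'.IsGloballyMinimal] (hiso : IsIsogenous Wd V')
    (S₀ : Finset (HeightOneSpectrum (𝓞 ℚ))) (Φ₀ : AddSubgroup (V'.geomTorsion (p : ℤ)))
    (m : ℕ) [NeZero m] (φ : DirichletCharacter (ZMod p) m)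
    (d : ℕ) [NeZero d] (ψ : DirichletCharacter (ZMod p) d)
    (hΦ : IsRationalLine V' p Φ₀) (hram : ¬ LineUnramifiedAt V' p Φ₀) (heven : LineEven V' p Φ₀)
    (hφ : φ.IsPrimitive) (hψ : ψ.IsPrimitive) (hpm : p ∣ m) (hpd : ¬ p ∣ d)
    (hφ0 : ∀ (σ : absoluteGaloisGroup ℚ), ∀ Q ∈ Φ₀,
      σ • Q = (φ ((modNCyclotomicCharacter ℚ m σ : (ZMod m)ˣ) : ZMod m)).val • Q)
    (hψ0 : ∀ (σ : absoluteGaloisGroup ℚ) (Q : V'.geomTorsion (p : ℤ)),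
      σ • Q - (ψ ((modNCyclotomicCharacter ℚ d σ : (ZMod d)ˣ) : ZMod d)).val • Q ∈ Φ₀)
    (hS₀p : ∀ v ∈ S₀, ((p : ℕ) : 𝓞 ℚ) ∉ v.asIdeal)
    (hS : ∀ v : HeightOneSpectrum (𝓞 ℚ), v ∉ S₀ → ((p : ℕ) : 𝓞 ℚ) ∉ v.asIdeal → V'.HasGoodReductionAt v)
    (hφψ : ∀ a : ℕ, ¬ p ∣ a → φ (a : ZMod m) * (a : ZMod p)⁻¹ = ψ⁻¹ (a : ZMod d))
    (hB : ‖twistedBernoulli p 1 d (fun a : ℕ ↦ teichmullerLift p (ψ (a : ZMod d))⁻¹)‖ = 1)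
    (hbal : 1 + ∑ v ∈ S₀, delta V' p v =
      ∑ v ∈ S₀, ((if φ (Rat.HeightOneSpectrum.natGenerator v : ZMod m) =
            (Rat.HeightOneSpectrum.natGenerator v : ZMod p)
          then sFactor p (Rat.HeightOneSpectrum.natGenerator v) else 0) +
        (if ψ (Rat.HeightOneSpectrum.natGenerator v : ZMod d) =
            (Rat.HeightOneSpectrum.natGenerator v : ZMod p)
          then sFactor p (Rat.HeightOneSpectrum.natGenerator v) else 0))) :
    X2.MazurMainConjectureAt W p := by
  have hψp : ψ (p : ZMod d) ≠ 1 :=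
    (psi_natCast_ne_one_of_twist_carrier W p hc.2.1.1 hc.2.1.2.2 hns K hK hHp Wd hWd V' hiso hΦ hram ψ
      hpd hψ0).2
  exact mazurMainConjectureAt_of_cellB_of_not_split_of_indexLowerBoundAt_of_bernoulliUnit_twist hP hDis h311 W p hc
    hns N K Dt H ι P hK hodd hlt hN hHN hHp hPt hcM Wd hWd hrd hlow V' hiso S₀ Φ₀ m φ d ψ hΦ hram heven hφ hψ hpm
    hpd hφ0 hψ0 hS₀p hS hφψ hψp hB hbal

end Summit.BirchSwinnertonDyer.BirchSwinnertonDyer.Theorems.EisensteinPrimesMazurMCOnCellBTwistbackKLFlatPartnerUnitsPsi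

end
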